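import Summits.NavierStokesRegularity.NavierStokesRegularity.Theses.SlicedKelvin
import Summits.NavierStokesRegularity.NavierStokesRegularity.Theorems.SlicedKelvinPlanarFluxAPrioriStubDecayPersistence
import Summits.NavierStokesRegularity.NavierStokesRegularity.Theorems.SlicedKelvinPlanarFluxAPrioriStubFluxOfCubicDecay
import Summits.NavierStokesRegularity.NavierStokesRegularity.Theorems.SlicedKelvinPlanarFluxAPrioriStubVorticityMassBound
import Summits.NavierStokesRegularity.NavierStokesRegularity.Theorems.SlicedKelvinPlanarFluxAPrioriStubSlabSplit
import Summits.NavierStokesRegularity.NavierStokesRegularity.Theorems.SlicedKelvinPlanarFluxAPrioriStubApexLipschitz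
import Literature.Analysis.FluidPDE.ConstantinDirectionDissipationProofs
import HarnessLib.Audit

/-!
# Skeleton (rev 4) of the crux `SlicedKelvin.PlanarFluxAPriori` — line `Sketch` (= card
`halfspace-apex-identity`, crux-ideate r1 k2)

(crux item `stmt-NavierStokesRegularity-15600`, rank 2, route `route-NavierStokesRegularity-SlicedKelvin`;
tree path `Cruxes/PlanarFluxAPriori/Lines/Sketch.lean`; lead `prover-line-stmt-NavierStokesRegularity-15600-c1-0`,
2026-08-17.)

THE CUT (half-space apex identity). For a smooth decaying field `v`, a frame `R` (normal `n = R e₂`),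
`ω = curl v`, `f = ⟪ω, n⟫`, `q = Df[ω] = (ω·∇)f` and the odd regularisation `H_ε(s) = s/√(s²+ε²)`
(`H_ε' = ε²/√(s²+ε²)³`, mass 2), one divergence theorem on the slab between the planes `Π_c = R{x₂ = c}`
and `Π_{c'}` applied to the field `H_ε(f)·ω` (`div ω = 0`) gives
`∫_{Π_c} f²/√(f²+ε²) − ∫_{Π_{c'}} f²/√(f²+ε²) = ± ∫_{slab(c,c')} H_ε'(f)·q`, hence the LIPSCHITZ LAW
`∫_{Π_c} f²/√(f²+ε²) ≤ ∫_{Π_{c'}} f²/√(f²+ε²) + ∫_{slab(c,c')} H_ε'(f)|q|` (`stub_apexLipschitz`). Averaging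
over `c' ∈ (c−h, c+h)`, Fubini over the foliation (`∫ Φ(c') dc' = ‖f‖_{L¹(ℝ³)}`) and `ε → 0⁺`
(`√(f²+ε²) − ε ≤ f²/√(f²+ε²) ≤ |f|`, monotone convergence) give the SLAB SPLIT
`Φ(c) ≤ ‖f‖_{L¹(ℝ³)}/(2h) + liminf_{ε→0⁺} ∫_{|⟪x,n⟫−c|<h} H_ε'(f)|q|` (`stub_slabSplit`, stated with the
Lipschitz law as hypothesis). Along the solution: the large scales are paid by CONSTANTIN's a-priori
`L¹` vorticity bound `‖ω(t)‖₁ ≤ ‖ω₀‖₁ + (2ν)⁻¹‖u₀‖₂²` (`stub_vorticityMassBound`, Constantin 1990 Thm 2.1 —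
the in-tree proof of `constantin1990_direction_dissipation_bound_holds` keeps the dissipation and drops the
end term; this stub keeps the end term), the window `[0, T/2]` is paid by decay persistence
(`Theorems.SlicedKelvinPlanarFluxAPriori.stub_decayPersistence`, LANDED p156374) through the kinematic
`stub_fluxOfCubicDecay`, and the remaining content is the OPEN transfer target of the card,
`stub_slabApexBound` (C⁺, positive-time form): no Γ-weighted crowding of vortex-line apexes in a slab of
width `h`, uniformly on `[T/2, T)`, over frames and heights.

STUBS (registered): `stub_fluxOfCubicDecay` [S, kinematic — LANDED p159380], `stub_vorticityMassBound` [L,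
known theorem: Constantin 1990 — LANDED p159829], `stub_apexLipschitz` [L, kinematic: the apex identity —
LANDED p160844], `stub_slabSplit` [M/L, kinematic bookkeeping in `ℝ≥0∞` — LANDED p160020], `stub_slabApexBound`
[XL, OPEN — the hardest stub, held by the lead; the ONLY remaining `sorry` since rev 4]. The closed reduction
`Theorems.SlicedKelvinPlanarFluxAPriori.planarFluxAPriori_of_apexLipschitz_of_slabApexBound` is LANDED (p160485).

COMPOSITION. `planarFluxAPriori_of_stubs` (closed) and
`PlanarFluxAPriori_of : Theses.SlicedKelvin.PlanarFluxAPriori` (A12 by-name form); since rev 4 `sorry` only inside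
the single registered stub `stub_slabApexBound`.
-/

noncomputable section

namespace Summit.NavierStokesRegularity.NavierStokesRegularity.Cruxes.PlanarFluxAPriori.Sketch

set_option linter.unusedVariables false
set_option linter.dupNamespace false

open MeasureTheory Set Filter Literature.Analysis.FluidPDE
open scoped ENNReal NNReal Topology

/-- **stub 1 — CLOSED (landed p159380, `Theorems.SlicedKelvinPlanarFluxAPriori.stub_fluxOfCubicDecay`).**
Cubic decay of the gradient bounds the unsigned planar vorticity flux uniformly over frames and heights:
`∫_{R{x₂=c}} |curl v · R e₂| ≤ 6C ∫_{ℝ²} (1+|y|)⁻³ dy`. -/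
theorem fluxOfCubicDecay :
    ∀ (v : EuclideanSpace ℝ (Fin 3) → EuclideanSpace ℝ (Fin 3)) (C : ℝ),
      (∀ x : EuclideanSpace ℝ (Fin 3), (1 + ‖x‖) ^ 3 * ‖iteratedFDeriv ℝ 1 v x‖ ≤ C) →
      ∀ (R : EuclideanSpace ℝ (Fin 3) ≃ₗᵢ[ℝ] EuclideanSpace ℝ (Fin 3)) (c : ℝ),
        ∫⁻ y : EuclideanSpace ℝ (Fin 2), ‖inner ℝ (Literature.Analysis.FluidPDE.curl v
          (R (WithLp.toLp 2 ![y 0, y 1, c]))) (R (EuclideanSpace.single 2 1))‖ₑ ≤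
        ENNReal.ofReal (6 * C) * ∫⁻ y : EuclideanSpace ℝ (Fin 2), ENNReal.ofReal ((1 + ‖y‖) ^ (-(3 : ℝ))) :=
  _root_.Summit.NavierStokesRegularity.NavierStokesRegularity.Theorems.SlicedKelvinPlanarFluxAPriori.stub_fluxOfCubicDecay

/-- **stub 2 — CLOSED (landed p159829, `Theorems.SlicedKelvinPlanarFluxAPriori.stub_vorticityMassBound`):
Constantin's a-priori `L¹` vorticity bound (Constantin 1990, Thm 2.1/2.2).** Along a classical Leray–Hopf solution
from a rapidly decaying datum: `‖curl u(t)‖_{L¹(ℝ³)} ≤ ‖curl u(0)‖_{L¹} + (2ν)⁻¹‖u(0)‖²_{L²}`, `t ∈ [0,T)`. -/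
theorem vorticityMassBound :
    ∀ (ν T : ℝ), 0 < ν → 0 < T → ∀ (u : ℝ → EuclideanSpace ℝ (Fin 3) → EuclideanSpace ℝ (Fin 3))
      (p : ℝ → EuclideanSpace ℝ (Fin 3) → ℝ),
      Literature.Analysis.FluidPDE.IsClassicalNSSolutionOn (Set.Ico 0 T) ν 0 u p →
      Literature.Analysis.FluidPDE.IsLerayHopfOn T ν 0 (u 0) u →
      Literature.Analysis.FluidPDE.HasRapidSpatialDecay (u 0) →
      ∀ t ∈ Set.Ico 0 T, ∫⁻ x, ‖Literature.Analysis.FluidPDE.curl (u t) x‖ₑ ≤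
        (∫⁻ x, ‖Literature.Analysis.FluidPDE.curl (u 0) x‖ₑ) +
          (ENNReal.ofReal (2 * ν))⁻¹ * ∫⁻ x, ‖u 0 x‖ₑ ^ 2 :=
  _root_.Summit.NavierStokesRegularity.NavierStokesRegularity.Theorems.SlicedKelvinPlanarFluxAPriori.stub_vorticityMassBound

/-- **stub 3 — CLOSED (landed p160844, `Theorems.SlicedKelvinPlanarFluxAPriori.stub_apexLipschitz`; helpers
ApexPointwise p160491, ApexSlab p160481): the half-space apex identity, Lipschitz form.** For a smooth field with
cubic decay, a frame `R` (`n = R e₂`), `f = ⟪curl v, n⟫`, `q = Df[curl v]` and `ε > 0`: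
`∫_{Π_c} f²/√(f²+ε²) ≤ ∫_{Π_{c'}} f²/√(f²+ε²) + ∫_{⟪x,n⟫ ∈ [c ⊓ c', c ⊔ c']} (ε²/√(f²+ε²)³)|q|`. -/
theorem apexLipschitz :
    ∀ (ε : ℝ), 0 < ε → ∀ (R : EuclideanSpace ℝ (Fin 3) ≃ₗᵢ[ℝ] EuclideanSpace ℝ (Fin 3)) (c c' : ℝ)
      (v : EuclideanSpace ℝ (Fin 3) → EuclideanSpace ℝ (Fin 3)), ContDiff ℝ (⊤ : ℕ∞) v →
      (∃ C : ℝ, ∀ (x : EuclideanSpace ℝ (Fin 3)) (k : ℕ), k ≤ 3 →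
        (1 + ‖x‖) ^ 3 * ‖iteratedFDeriv ℝ k v x‖ ≤ C) →
      ∫ y : EuclideanSpace ℝ (Fin 2), inner ℝ (Literature.Analysis.FluidPDE.curl v
          (R (WithLp.toLp 2 ![y 0, y 1, c]))) (R (EuclideanSpace.single 2 1)) ^ 2 /
          Real.sqrt (inner ℝ (Literature.Analysis.FluidPDE.curl v (R (WithLp.toLp 2 ![y 0, y 1, c])))
            (R (EuclideanSpace.single 2 1)) ^ 2 + ε ^ 2) ≤
      (∫ y : EuclideanSpace ℝ (Fin 2), inner ℝ (Literature.Analysis.FluidPDE.curl v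
          (R (WithLp.toLp 2 ![y 0, y 1, c']))) (R (EuclideanSpace.single 2 1)) ^ 2 /
          Real.sqrt (inner ℝ (Literature.Analysis.FluidPDE.curl v (R (WithLp.toLp 2 ![y 0, y 1, c'])))
            (R (EuclideanSpace.single 2 1)) ^ 2 + ε ^ 2)) +
      ∫ x in {x : EuclideanSpace ℝ (Fin 3) | inner ℝ x (R (EuclideanSpace.single 2 1)) ∈ Set.uIcc c c'},
        ε ^ 2 / Real.sqrt (inner ℝ (Literature.Analysis.FluidPDE.curl v x) (R (EuclideanSpace.single 2 1)) ^ 2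
          + ε ^ 2) ^ 3 *
        |fderiv ℝ (fun z => inner ℝ (Literature.Analysis.FluidPDE.curl v z) (R (EuclideanSpace.single 2 1))) x
          (Literature.Analysis.FluidPDE.curl v x)| :=
  _root_.Summit.NavierStokesRegularity.NavierStokesRegularity.Theorems.SlicedKelvinPlanarFluxAPriori.stub_apexLipschitz

/-- **stub 4 — CLOSED (landed p160020, `Theorems.SlicedKelvinPlanarFluxAPriori.stub_slabSplit`): the slab
split.** From the Lipschitz law (hypothesis = the statement of `stub_apexLipschitz`): for `h > 0`,
`Φ(c) ≤ ‖f‖_{L¹(ℝ³)}/(2h) + liminf_{ε→0⁺} ∫_{|⟪x,n⟫−c|<h} (ε²/√(f²+ε²)³)|q|` in `ℝ≥0∞`. -/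
theorem slabSplit :
    (∀ (ε : ℝ), 0 < ε → ∀ (R : EuclideanSpace ℝ (Fin 3) ≃ₗᵢ[ℝ] EuclideanSpace ℝ (Fin 3)) (c c' : ℝ)
      (v : EuclideanSpace ℝ (Fin 3) → EuclideanSpace ℝ (Fin 3)), ContDiff ℝ (⊤ : ℕ∞) v →
      (∃ C : ℝ, ∀ (x : EuclideanSpace ℝ (Fin 3)) (k : ℕ), k ≤ 3 →
        (1 + ‖x‖) ^ 3 * ‖iteratedFDeriv ℝ k v x‖ ≤ C) →
      ∫ y : EuclideanSpace ℝ (Fin 2), inner ℝ (Literature.Analysis.FluidPDE.curl v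
          (R (WithLp.toLp 2 ![y 0, y 1, c]))) (R (EuclideanSpace.single 2 1)) ^ 2 /
          Real.sqrt (inner ℝ (Literature.Analysis.FluidPDE.curl v (R (WithLp.toLp 2 ![y 0, y 1, c])))
            (R (EuclideanSpace.single 2 1)) ^ 2 + ε ^ 2) ≤
      (∫ y : EuclideanSpace ℝ (Fin 2), inner ℝ (Literature.Analysis.FluidPDE.curl v
          (R (WithLp.toLp 2 ![y 0, y 1, c']))) (R (EuclideanSpace.single 2 1)) ^ 2 /
          Real.sqrt (inner ℝ (Literature.Analysis.FluidPDE.curl v (R (WithLp.toLp 2 ![y 0, y 1, c'])))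
            (R (EuclideanSpace.single 2 1)) ^ 2 + ε ^ 2)) +
      ∫ x in {x : EuclideanSpace ℝ (Fin 3) | inner ℝ x (R (EuclideanSpace.single 2 1)) ∈ Set.uIcc c c'},
        ε ^ 2 / Real.sqrt (inner ℝ (Literature.Analysis.FluidPDE.curl v x) (R (EuclideanSpace.single 2 1)) ^ 2
          + ε ^ 2) ^ 3 *
        |fderiv ℝ (fun z => inner ℝ (Literature.Analysis.FluidPDE.curl v z) (R (EuclideanSpace.single 2 1))) x
          (Literature.Analysis.FluidPDE.curl v x)|) →
    ∀ (R : EuclideanSpace ℝ (Fin 3) ≃ₗᵢ[ℝ] EuclideanSpace ℝ (Fin 3)) (c h : ℝ), 0 < h →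
      ∀ (v : EuclideanSpace ℝ (Fin 3) → EuclideanSpace ℝ (Fin 3)), ContDiff ℝ (⊤ : ℕ∞) v →
      (∃ C : ℝ, ∀ (x : EuclideanSpace ℝ (Fin 3)) (k : ℕ), k ≤ 3 →
        (1 + ‖x‖) ^ 3 * ‖iteratedFDeriv ℝ k v x‖ ≤ C) →
      ∫⁻ y : EuclideanSpace ℝ (Fin 2), ‖inner ℝ (Literature.Analysis.FluidPDE.curl v
          (R (WithLp.toLp 2 ![y 0, y 1, c]))) (R (EuclideanSpace.single 2 1))‖ₑ ≤
      ENNReal.ofReal (1 / (2 * h)) *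
          (∫⁻ x, ‖inner ℝ (Literature.Analysis.FluidPDE.curl v x) (R (EuclideanSpace.single 2 1))‖ₑ) +
        Filter.liminf (fun ε : ℝ => ∫⁻ x in {x : EuclideanSpace ℝ (Fin 3) |
            |inner ℝ x (R (EuclideanSpace.single 2 1)) - c| < h},
          ENNReal.ofReal (ε ^ 2 / Real.sqrt (inner ℝ (Literature.Analysis.FluidPDE.curl v x)
            (R (EuclideanSpace.single 2 1)) ^ 2 + ε ^ 2) ^ 3 *
            |fderiv ℝ (fun z => inner ℝ (Literature.Analysis.FluidPDE.curl v z) (R (EuclideanSpace.single 2 1)))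
              x (Literature.Analysis.FluidPDE.curl v x)|)) (nhdsWithin 0 (Set.Ioi 0)) :=
  _root_.Summit.NavierStokesRegularity.NavierStokesRegularity.Theorems.SlicedKelvinPlanarFluxAPriori.stub_slabSplit

/-- **stub 5 — `stub_slabApexBound` [XL, OPEN — the hardest stub; the card's transfer target C⁺ in
positive-time form].** Along every classical Leray–Hopf solution on `[0,T)` from a rapidly decaying datum
and for every `t₀ ∈ (0,T)` there are `M` and a resolution `h > 0` such that the Γ-weighted apex measure of
every slab of width `2h` is at most `M`, uniformly in `t ∈ [t₀,T)`, frames `R` and heights `c`: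
`liminf_{ε→0⁺} ∫_{|⟪x,R e₂⟫−c|<h} (ε²/√(f²+ε²)³)|Df[curl u(t)]| ≤ M`, `f = ⟪curl u(t), R e₂⟫`. -/
theorem stub_slabApexBound :
    ∀ (ν T : ℝ), 0 < ν → 0 < T → ∀ (u : ℝ → EuclideanSpace ℝ (Fin 3) → EuclideanSpace ℝ (Fin 3))
      (p : ℝ → EuclideanSpace ℝ (Fin 3) → ℝ),
      Literature.Analysis.FluidPDE.IsClassicalNSSolutionOn (Set.Ico 0 T) ν 0 u p →
      Literature.Analysis.FluidPDE.IsLerayHopfOn T ν 0 (u 0) u →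
      Literature.Analysis.FluidPDE.HasRapidSpatialDecay (u 0) →
      ∀ t₀ ∈ Set.Ioo 0 T, ∃ M : NNReal, ∃ h : ℝ, 0 < h ∧ ∀ t ∈ Set.Ico t₀ T,
        ∀ (R : EuclideanSpace ℝ (Fin 3) ≃ₗᵢ[ℝ] EuclideanSpace ℝ (Fin 3)) (c : ℝ),
        Filter.liminf (fun ε : ℝ => ∫⁻ x in {x : EuclideanSpace ℝ (Fin 3) |
            |inner ℝ x (R (EuclideanSpace.single 2 1)) - c| < h},
          ENNReal.ofReal (ε ^ 2 / Real.sqrt (inner ℝ (Literature.Analysis.FluidPDE.curl (u t) x)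
            (R (EuclideanSpace.single 2 1)) ^ 2 + ε ^ 2) ^ 3 *
            |fderiv ℝ (fun z => inner ℝ (Literature.Analysis.FluidPDE.curl (u t) z) (R (EuclideanSpace.single 2 1)))
              x (Literature.Analysis.FluidPDE.curl (u t) x)|)) (nhdsWithin 0 (Set.Ioi 0)) ≤ (M : ENNReal) := by
  sorry

/-- `‖⟪a, R e₂⟫‖ₑ ≤ ‖a‖ₑ`: the normal component is at most the modulus (the frame vector is a unit vector). -/
theorem enorm_inner_frame_le (R : EuclideanSpace ℝ (Fin 3) ≃ₗᵢ[ℝ] EuclideanSpace ℝ (Fin 3))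
    (a : EuclideanSpace ℝ (Fin 3)) :
    ‖inner ℝ a (R (EuclideanSpace.single 2 1))‖ₑ ≤ ‖a‖ₑ := by
  rw [Real.enorm_eq_ofReal_abs, ← ofReal_norm]
  refine ENNReal.ofReal_le_ofReal ?_
  calc |inner ℝ a (R (EuclideanSpace.single 2 1))|
      ≤ ‖a‖ * ‖R (EuclideanSpace.single 2 (1 : ℝ))‖ := abs_real_inner_le_norm _ _
    _ = ‖a‖ := by rw [LinearIsometryEquiv.norm_map, PiLp.norm_single, norm_one, mul_one]

/-- Finiteness of Constantin's bound `‖curl u₀‖₁ + (2ν)⁻¹‖u₀‖₂²` in the crux class (rapid decay of the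
smooth datum gives `curl u₀ ∈ L¹`; the Leray–Hopf class gives `u₀ ∈ L²`). -/
theorem constantinBound_lt_top {ν T : ℝ} (hν : 0 < ν) (hT : 0 < T)
    {u : ℝ → EuclideanSpace ℝ (Fin 3) → EuclideanSpace ℝ (Fin 3)} {p : ℝ → EuclideanSpace ℝ (Fin 3) → ℝ}
    (hcl : IsClassicalNSSolutionOn (Set.Ico 0 T) ν 0 u p) (hLH : IsLerayHopfOn T ν 0 (u 0) u)
    (hdec : HasRapidSpatialDecay (u 0)) :
    (∫⁻ x, ‖curl (u 0) x‖ₑ) + (ENNReal.ofReal (2 * ν))⁻¹ * ∫⁻ x, ‖u 0 x‖ₑ ^ 2 < ⊤ := by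
  have h0T : (0 : ℝ) ∈ Set.Ico 0 T := ⟨le_rfl, hT⟩
  have hc1 : ContDiff ℝ 1 (u 0) := contDiff_infty.1 (hcl.contDiff_velocity h0T) 1
  have hω : ∫⁻ x, ‖curl (u 0) x‖ₑ < ⊤ := by
    have h := (integrable_norm_curl_of_hasRapidSpatialDecay hc1 hdec).hasFiniteIntegral
    simpa only [HasFiniteIntegral, enorm_norm] using h
  have hu2 : ∫⁻ x, ‖u 0 x‖ₑ ^ 2 < ⊤ := by
    have hmem : MemLp (u 0) 2 volume := hLH.memLp 0 ⟨le_rfl, hT.le⟩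
    have h := lintegral_rpow_enorm_lt_top_of_eLpNorm_lt_top (by norm_num) (by norm_num) hmem.eLpNorm_lt_top
    simpa only [ENNReal.toReal_ofNat, ENNReal.rpow_ofNat] using h
  have hinv : (ENNReal.ofReal (2 * ν))⁻¹ < ⊤ := by
    rw [ENNReal.inv_lt_top, ENNReal.ofReal_pos]
    positivity
  exact ENNReal.add_lt_top.2 ⟨hω, ENNReal.mul_lt_top hinv hu2⟩

/-- **Composition, closed form.** The five stub STATEMENTS (as hypotheses; the Lipschitz law enters only
through `stub_slabSplit`) together with the LANDED decay persistence imply the crux statement (conclusion =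
the body of `Theses.SlicedKelvin.PlanarFluxAPriori`, verbatim): on `[0, T/2]` the flux is bounded by decay
persistence and `stub_fluxOfCubicDecay`; on `[T/2, T)` by the slab split, Constantin's `L¹` bound and the
slab apex bound; `M := (6C₀·I₂ + A₀/(2h) + M_apex).toReal`, all three pieces finite. -/
theorem planarFluxAPriori_of_stubs
    (h1 : ∀ (v : EuclideanSpace ℝ (Fin 3) → EuclideanSpace ℝ (Fin 3)) (C : ℝ),
      (∀ x : EuclideanSpace ℝ (Fin 3), (1 + ‖x‖) ^ 3 * ‖iteratedFDeriv ℝ 1 v x‖ ≤ C) →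
      ∀ (R : EuclideanSpace ℝ (Fin 3) ≃ₗᵢ[ℝ] EuclideanSpace ℝ (Fin 3)) (c : ℝ),
        ∫⁻ y : EuclideanSpace ℝ (Fin 2), ‖inner ℝ (Literature.Analysis.FluidPDE.curl v
          (R (WithLp.toLp 2 ![y 0, y 1, c]))) (R (EuclideanSpace.single 2 1))‖ₑ ≤
        ENNReal.ofReal (6 * C) * ∫⁻ y : EuclideanSpace ℝ (Fin 2), ENNReal.ofReal ((1 + ‖y‖) ^ (-(3 : ℝ))))
    (h2 : ∀ (ν T : ℝ), 0 < ν → 0 < T → ∀ (u : ℝ → EuclideanSpace ℝ (Fin 3) → EuclideanSpace ℝ (Fin 3))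
      (p : ℝ → EuclideanSpace ℝ (Fin 3) → ℝ),
      Literature.Analysis.FluidPDE.IsClassicalNSSolutionOn (Set.Ico 0 T) ν 0 u p →
      Literature.Analysis.FluidPDE.IsLerayHopfOn T ν 0 (u 0) u →
      Literature.Analysis.FluidPDE.HasRapidSpatialDecay (u 0) →
      ∀ t ∈ Set.Ico 0 T, ∫⁻ x, ‖Literature.Analysis.FluidPDE.curl (u t) x‖ₑ ≤
        (∫⁻ x, ‖Literature.Analysis.FluidPDE.curl (u 0) x‖ₑ) +
          (ENNReal.ofReal (2 * ν))⁻¹ * ∫⁻ x, ‖u 0 x‖ₑ ^ 2)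
    (h4 : ∀ (R : EuclideanSpace ℝ (Fin 3) ≃ₗᵢ[ℝ] EuclideanSpace ℝ (Fin 3)) (c h : ℝ), 0 < h →
      ∀ (v : EuclideanSpace ℝ (Fin 3) → EuclideanSpace ℝ (Fin 3)), ContDiff ℝ (⊤ : ℕ∞) v →
      (∃ C : ℝ, ∀ (x : EuclideanSpace ℝ (Fin 3)) (k : ℕ), k ≤ 3 →
        (1 + ‖x‖) ^ 3 * ‖iteratedFDeriv ℝ k v x‖ ≤ C) →
      ∫⁻ y : EuclideanSpace ℝ (Fin 2), ‖inner ℝ (Literature.Analysis.FluidPDE.curl v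
          (R (WithLp.toLp 2 ![y 0, y 1, c]))) (R (EuclideanSpace.single 2 1))‖ₑ ≤
      ENNReal.ofReal (1 / (2 * h)) *
          (∫⁻ x, ‖inner ℝ (Literature.Analysis.FluidPDE.curl v x) (R (EuclideanSpace.single 2 1))‖ₑ) +
        Filter.liminf (fun ε : ℝ => ∫⁻ x in {x : EuclideanSpace ℝ (Fin 3) |
            |inner ℝ x (R (EuclideanSpace.single 2 1)) - c| < h},
          ENNReal.ofReal (ε ^ 2 / Real.sqrt (inner ℝ (Literature.Analysis.FluidPDE.curl v x)
            (R (EuclideanSpace.single 2 1)) ^ 2 + ε ^ 2) ^ 3 *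
            |fderiv ℝ (fun z => inner ℝ (Literature.Analysis.FluidPDE.curl v z) (R (EuclideanSpace.single 2 1)))
              x (Literature.Analysis.FluidPDE.curl v x)|)) (nhdsWithin 0 (Set.Ioi 0)))
    (h5 : ∀ (ν T : ℝ), 0 < ν → 0 < T → ∀ (u : ℝ → EuclideanSpace ℝ (Fin 3) → EuclideanSpace ℝ (Fin 3))
      (p : ℝ → EuclideanSpace ℝ (Fin 3) → ℝ),
      Literature.Analysis.FluidPDE.IsClassicalNSSolutionOn (Set.Ico 0 T) ν 0 u p →
      Literature.Analysis.FluidPDE.IsLerayHopfOn T ν 0 (u 0) u →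
      Literature.Analysis.FluidPDE.HasRapidSpatialDecay (u 0) →
      ∀ t₀ ∈ Set.Ioo 0 T, ∃ M : NNReal, ∃ h : ℝ, 0 < h ∧ ∀ t ∈ Set.Ico t₀ T,
        ∀ (R : EuclideanSpace ℝ (Fin 3) ≃ₗᵢ[ℝ] EuclideanSpace ℝ (Fin 3)) (c : ℝ),
        Filter.liminf (fun ε : ℝ => ∫⁻ x in {x : EuclideanSpace ℝ (Fin 3) |
            |inner ℝ x (R (EuclideanSpace.single 2 1)) - c| < h},
          ENNReal.ofReal (ε ^ 2 / Real.sqrt (inner ℝ (Literature.Analysis.FluidPDE.curl (u t) x)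
            (R (EuclideanSpace.single 2 1)) ^ 2 + ε ^ 2) ^ 3 *
            |fderiv ℝ (fun z => inner ℝ (Literature.Analysis.FluidPDE.curl (u t) z) (R (EuclideanSpace.single 2 1)))
              x (Literature.Analysis.FluidPDE.curl (u t) x)|)) (nhdsWithin 0 (Set.Ioi 0)) ≤ (M : ENNReal))
    (hdp : ∀ (ν T : ℝ), 0 < ν → 0 < T → ∀ (u : ℝ → EuclideanSpace ℝ (Fin 3) → EuclideanSpace ℝ (Fin 3))
      (p : ℝ → EuclideanSpace ℝ (Fin 3) → ℝ),
      Literature.Analysis.FluidPDE.IsClassicalNSSolutionOn (Set.Ico 0 T) ν 0 u p →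
      Literature.Analysis.FluidPDE.IsLerayHopfOn T ν 0 (u 0) u →
      Literature.Analysis.FluidPDE.HasRapidSpatialDecay (u 0) → ∀ t ∈ Set.Ico 0 T, ∃ C₀ : ℝ,
      ∀ s ∈ Set.Icc 0 t, ∀ (x : EuclideanSpace ℝ (Fin 3)) (k : ℕ), k ≤ 3 →
        (1 + ‖x‖) ^ 3 * ‖iteratedFDeriv ℝ k (u s) x‖ ≤ C₀) :
    ∀ (ν T : ℝ), 0 < ν → 0 < T → ∀ (u : ℝ → EuclideanSpace ℝ (Fin 3) → EuclideanSpace ℝ (Fin 3)) (p : ℝ →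
      EuclideanSpace ℝ (Fin 3) → ℝ), Literature.Analysis.FluidPDE.IsClassicalNSSolutionOn (Set.Ico 0 T) ν 0
      u p → Literature.Analysis.FluidPDE.IsLerayHopfOn T ν 0 (u 0) u →
      Literature.Analysis.FluidPDE.HasRapidSpatialDecay (u 0) → ∃ M : ℝ, ∀ t ∈ Set.Ico 0 T, ∀ (R :
      EuclideanSpace ℝ (Fin 3) ≃ₗᵢ[ℝ] EuclideanSpace ℝ (Fin 3)) (c : ℝ), ∫⁻ y : EuclideanSpace ℝ (Fin 2),
      ‖inner ℝ (Literature.Analysis.FluidPDE.curl (u t) (R (WithLp.toLp 2 ![y 0, y 1, c]))) (R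
      (EuclideanSpace.single 2 1))‖ₑ ≤ ENNReal.ofReal M := by
  intro ν T hν hT u p hcl hLH hdec
  have ht₀ : T / 2 ∈ Set.Ioo 0 T := ⟨by positivity, by linarith⟩
  have ht₀' : T / 2 ∈ Set.Ico 0 T := ⟨by positivity, by linarith⟩
  -- decay on the window `[0, T/2]`
  obtain ⟨C₀, hC₀⟩ := hdp ν T hν hT u p hcl hLH hdec (T / 2) ht₀'
  -- the apex bound on `[T/2, T)`
  obtain ⟨M, h, hh, hM⟩ := h5 ν T hν hT u p hcl hLH hdec (T / 2) ht₀
  -- the three finite constants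
  set I₂ : ℝ≥0∞ := ∫⁻ y : EuclideanSpace ℝ (Fin 2), ENNReal.ofReal ((1 + ‖y‖) ^ (-(3 : ℝ))) with hI₂
  have hI₂_lt : I₂ < ⊤ :=
    finite_integral_one_add_norm (by rw [finrank_euclideanSpace_fin]; norm_num)
  set A₀ : ℝ≥0∞ := (∫⁻ x, ‖curl (u 0) x‖ₑ) + (ENNReal.ofReal (2 * ν))⁻¹ * ∫⁻ x, ‖u 0 x‖ₑ ^ 2 with hA₀
  have hA₀_lt : A₀ < ⊤ := constantinBound_lt_top hν hT hcl hLH hdec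
  set K : ℝ≥0∞ := ENNReal.ofReal (6 * C₀) * I₂ + (ENNReal.ofReal (1 / (2 * h)) * A₀ + (M : ℝ≥0∞)) with hK
  have hK_lt : K < ⊤ := by
    refine ENNReal.add_lt_top.2 ⟨ENNReal.mul_lt_top ENNReal.ofReal_lt_top hI₂_lt,
      ENNReal.add_lt_top.2 ⟨ENNReal.mul_lt_top ENNReal.ofReal_lt_top hA₀_lt, ENNReal.coe_lt_top⟩⟩
  refine ⟨K.toReal, fun t ht R c => ?_⟩
  rw [ENNReal.ofReal_toReal hK_lt.ne]
  rcases lt_or_ge t (T / 2) with hlt | hge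
  · -- the short-time window: decay persistence + the kinematic flux bound
    have hs : t ∈ Set.Icc 0 (T / 2) := ⟨ht.1, hlt.le⟩
    exact (h1 (u t) C₀ (fun x => hC₀ t hs x 1 (by norm_num)) R c).trans le_self_add
  · -- `t ∈ [T/2, T)`: slab split + Constantin + apex bound
    have ht' : t ∈ Set.Ico (T / 2) T := ⟨hge, ht.2⟩
    obtain ⟨C₁, hC₁⟩ := hdp ν T hν hT u p hcl hLH hdec t ht
    have hdecay : ∃ C : ℝ, ∀ (x : EuclideanSpace ℝ (Fin 3)) (k : ℕ), k ≤ 3 →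
        (1 + ‖x‖) ^ 3 * ‖iteratedFDeriv ℝ k (u t) x‖ ≤ C :=
      ⟨C₁, fun x k hk => hC₁ t ⟨ht.1, le_rfl⟩ x k hk⟩
    have hsmooth : ContDiff ℝ (⊤ : ℕ∞) (u t) := hcl.contDiff_velocity ht
    have hfn : ∫⁻ x, ‖inner ℝ (curl (u t) x) (R (EuclideanSpace.single 2 1))‖ₑ ≤ A₀ :=
      (lintegral_mono fun x => enorm_inner_frame_le R (curl (u t) x)).trans
        (h2 ν T hν hT u p hcl hLH hdec t ht)
    calc ∫⁻ y : EuclideanSpace ℝ (Fin 2), ‖inner ℝ (curl (u t) (R (WithLp.toLp 2 ![y 0, y 1, c])))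
          (R (EuclideanSpace.single 2 1))‖ₑ
        ≤ ENNReal.ofReal (1 / (2 * h)) *
            (∫⁻ x, ‖inner ℝ (curl (u t) x) (R (EuclideanSpace.single 2 1))‖ₑ) + _ :=
          h4 R c h hh (u t) hsmooth hdecay
      _ ≤ ENNReal.ofReal (1 / (2 * h)) * A₀ + (M : ℝ≥0∞) :=
          add_le_add (by gcongr) (hM t ht' R c)
      _ ≤ K := le_add_self

/-- **The skeleton (A12 by-name form).** The crux BY NAME, modulo the registered stubs; decay persistence is
the LANDED `Theorems.SlicedKelvinPlanarFluxAPriori.stub_decayPersistence` (p156374). -/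
theorem PlanarFluxAPriori_of : Theses.SlicedKelvin.PlanarFluxAPriori :=
  planarFluxAPriori_of_stubs fluxOfCubicDecay vorticityMassBound (slabSplit apexLipschitz)
    stub_slabApexBound
    _root_.Summit.NavierStokesRegularity.NavierStokesRegularity.Theorems.SlicedKelvinPlanarFluxAPriori.stub_decayPersistence

end Summit.NavierStokesRegularity.NavierStokesRegularity.Cruxes.PlanarFluxAPriori.Sketch

end
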